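import Literature.Probability.Distributions.GaussianWidthStatDist
import Mathlib.InformationTheory.KullbackLeibler.Basic
import Mathlib.Analysis.SpecialFunctions.Log.Deriv
import HarnessLib

/-!
# Route `ColdStartUniversality`, crux K_A1 `UniformColdStartMixing` (stmt-QuantumFields-24809), line
# `cold_entropy`: support stub `stub_ouModeEntropy` — the one-mode Ornstein–Uhlenbeck entropy

Helper file (seat `ym-line-csu-p1`; a `--supports 24809` node of the planner's line «cold_entropy», registered
stub `stub_ouModeEntropy`, statement `OUModeEntropy` verbatim).  The OU mode `dX = -κ X ds + σ dB` started at
`0` has law `N(0, v(1 - e^{-2κs}))` at time `s` (`v` = equilibrium variance); its relative entropy w.r.t.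
`N(0, v)` is `½(-x - log(1 - x)) ≤ x²/(4(1 - x))`, `x = e^{-2κs}`:

* `toReal_klDiv_gaussianReal_centred` — `KL(N(0,v) ‖ N(0,w)) = ½(v/w - 1 - log(v/w))` (the closed Gaussian
  formula; adapted from the private lemmas of `Literature/Probability/MarkovChains/LangevinStepBias.lean`);
* `neg_log_one_sub_sub_le` — `-log(1 - x) - x ≤ x²/(2(1 - x))` on `[0, 1)` (power series of the logarithm);
* `ouModeEntropy` — the registered statement.

No definition, no sorry.  RECORD-rung plumbing; this proves nothing about K_A1 or the mass gap. -/

set_option autoImplicit false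

noncomputable section

namespace Summit.QuantumFields.YangMills.Theorems.ColdStartUniversality

open MeasureTheory ProbabilityTheory InformationTheory
open scoped NNReal ENNReal

/-! ### KL divergence of centred Gaussians (adapted from `LangevinStepBias`, private there) -/

/-- Ratio of two centred Gaussian densities: `φ_v(x)/φ_w(x) = √(w/v) · exp(x²(1/w − 1/v)/2)`. [folklore] -/
theorem gaussianPDFReal_div_centred {v w : ℝ≥0} (hv : v ≠ 0) (hw : w ≠ 0) (x : ℝ) :
    gaussianPDFReal 0 v x / gaussianPDFReal 0 w x =
      Real.sqrt ((w : ℝ) / v) * Real.exp (x ^ 2 * (1 / (w : ℝ) - 1 / v) / 2) := by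
  have hv' : (0 : ℝ) < v := by exact_mod_cast pos_iff_ne_zero.2 hv
  have hw' : (0 : ℝ) < w := by exact_mod_cast pos_iff_ne_zero.2 hw
  simp only [gaussianPDFReal_def, sub_zero]
  rw [show Real.sqrt ((w : ℝ) / v) = (Real.sqrt (2 * Real.pi * v))⁻¹ / (Real.sqrt (2 * Real.pi * w))⁻¹ by
    rw [inv_div_inv, ← Real.sqrt_div (by positivity)]
    congr 1
    field_simp]
  rw [mul_div_mul_comm, ← Real.exp_sub]
  congr 2
  field_simp
  ring

/-- `N(0, v) = (φ_v/φ_w) · N(0, w)`. [folklore] -/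
theorem gaussianReal_eq_withDensity_div_centred {v w : ℝ≥0} (hv : v ≠ 0) (hw : w ≠ 0) :
    gaussianReal 0 v = (gaussianReal 0 w).withDensity
      (fun x => ENNReal.ofReal (gaussianPDFReal 0 v x / gaussianPDFReal 0 w x)) := by
  have hmeas : Measurable fun x => ENNReal.ofReal (gaussianPDFReal 0 v x / gaussianPDFReal 0 w x) :=
    Measurable.ennreal_ofReal (by fun_prop)
  rw [gaussianReal_of_var_ne_zero _ hv, gaussianReal_of_var_ne_zero _ hw,
    ← withDensity_mul _ (measurable_gaussianPDF 0 w) hmeas]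
  congr 1
  funext x
  simp only [Pi.mul_apply, gaussianPDF]
  rw [← ENNReal.ofReal_mul (gaussianPDFReal_nonneg _ _ _),
    mul_div_cancel₀ _ (gaussianPDFReal_pos _ _ _ hw).ne']

/-- `N(0, v) ≪ N(0, w)` for nondegenerate variances. [folklore] -/
theorem gaussianReal_ac_centred {v w : ℝ≥0} (hv : v ≠ 0) (hw : w ≠ 0) :
    gaussianReal 0 v ≪ gaussianReal 0 w := by
  rw [gaussianReal_eq_withDensity_div_centred hv hw]
  exact withDensity_absolutelyContinuous _ _

/-- The log-likelihood ratio of two centred Gaussians, a.e.: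
`log(dN(0,v)/dN(0,w))(x) = ½ log(w/v) + x²(1/w − 1/v)/2`. [folklore] -/
theorem llr_gaussianReal_centred_ae {v w : ℝ≥0} (hv : v ≠ 0) (hw : w ≠ 0) :
    llr (gaussianReal 0 v) (gaussianReal 0 w) =ᵐ[gaussianReal 0 v]
      fun x => Real.log ((w : ℝ) / v) / 2 + (1 / (w : ℝ) - 1 / v) / 2 * x ^ 2 := by
  have hv' : (0 : ℝ) < v := by exact_mod_cast pos_iff_ne_zero.2 hv
  have hw' : (0 : ℝ) < w := by exact_mod_cast pos_iff_ne_zero.2 hw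
  have hmeas : Measurable fun x => ENNReal.ofReal (gaussianPDFReal 0 v x / gaussianPDFReal 0 w x) :=
    Measurable.ennreal_ofReal (by fun_prop)
  have hrn := Measure.rnDeriv_withDensity (gaussianReal 0 w) hmeas
  rw [← gaussianReal_eq_withDensity_div_centred hv hw] at hrn
  filter_upwards [(gaussianReal_ac_centred hv hw).ae_eq hrn] with x hx
  rw [llr, hx, ENNReal.toReal_ofReal (div_nonneg (gaussianPDFReal_nonneg _ _ _)
    (gaussianPDFReal_nonneg _ _ _)), gaussianPDFReal_div_centred hv hw,
    Real.log_mul (Real.sqrt_pos.2 (by positivity)).ne' (Real.exp_pos _).ne',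
    Real.log_sqrt (by positivity), Real.log_exp]
  ring

/-- The log-likelihood ratio of two centred Gaussians is integrable. [folklore] -/
theorem integrable_llr_gaussianReal_centred {v w : ℝ≥0} (hv : v ≠ 0) (hw : w ≠ 0) :
    Integrable (llr (gaussianReal 0 v) (gaussianReal 0 w)) (gaussianReal 0 v) := by
  refine Integrable.congr ?_ (llr_gaussianReal_centred_ae hv hw).symm
  exact (integrable_const _).add ((Literature.Probability.Distributions.integrable_sq_gaussianReal_zero v).const_mul _)

/-- **KL divergence of two centred Gaussians**: `KL(N(0,v) ‖ N(0,w)) = ½ (v/w − 1 − log(v/w))`. [folklore] -/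
theorem toReal_klDiv_gaussianReal_centred {v w : ℝ≥0} (hv : v ≠ 0) (hw : w ≠ 0) :
    (klDiv (gaussianReal 0 v) (gaussianReal 0 w)).toReal =
      ((v : ℝ) / w - 1 - Real.log ((v : ℝ) / w)) / 2 := by
  have hv' : (0 : ℝ) < v := by exact_mod_cast pos_iff_ne_zero.2 hv
  have hw' : (0 : ℝ) < w := by exact_mod_cast pos_iff_ne_zero.2 hw
  rw [toReal_klDiv_of_measure_eq (gaussianReal_ac_centred hv hw) (by simp),
    integral_congr_ae (llr_gaussianReal_centred_ae hv hw),
    integral_add (integrable_const _) ((Literature.Probability.Distributions.integrable_sq_gaussianReal_zero v).const_mul _),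
    integral_const_mul, Literature.Probability.Distributions.integral_sq_gaussianReal_zero]
  simp only [integral_const, probReal_univ, smul_eq_mul, one_mul]
  rw [Real.log_div hw'.ne' hv'.ne', Real.log_div hv'.ne' hw'.ne']
  have hv'' : (v : ℝ) ≠ 0 := hv'.ne'
  have hw'' : (w : ℝ) ≠ 0 := hw'.ne'
  have key : ((1 : ℝ) / w - 1 / v) / 2 * v = ((v : ℝ) / w - 1) / 2 := by
    field_simp
  rw [key]
  ring

/-- The KL divergence of two nondegenerate centred Gaussians is finite. [folklore] -/
theorem klDiv_gaussianReal_centred_ne_top {v w : ℝ≥0} (hv : v ≠ 0) (hw : w ≠ 0) :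
    klDiv (gaussianReal 0 v) (gaussianReal 0 w) ≠ ⊤ :=
  klDiv_ne_top (gaussianReal_ac_centred hv hw) (integrable_llr_gaussianReal_centred hv hw)

/-! ### The elementary inequality -/

/-- `-log(1 - x) - x ≤ x²/(2(1 - x))` for `0 ≤ x < 1` (compare the power series `Σ_{n≥2} xⁿ/n` with
`½ Σ_{n≥2} xⁿ`). [folklore] -/
theorem neg_log_one_sub_sub_le {x : ℝ} (h0 : 0 ≤ x) (h1 : x < 1) :
    -Real.log (1 - x) - x ≤ x ^ 2 / (2 * (1 - x)) := by
  have habs : |x| < 1 := abs_lt.2 ⟨by linarith, h1⟩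
  have hlog := Real.hasSum_pow_div_log_of_abs_lt_one habs
  -- split off the `n = 0` term
  have htail : HasSum (fun n : ℕ => x ^ (n + 2) / ((n : ℝ) + 2)) (-Real.log (1 - x) - x) := by
    have h := (hasSum_nat_add_iff' 1).2 hlog
    simp only [Finset.sum_range_one, pow_one, Nat.cast_zero, zero_add, div_one] at h
    have hfun : (fun n : ℕ => x ^ (n + 1 + 1) / (((n + 1 : ℕ) : ℝ) + 1)) =
        fun n : ℕ => x ^ (n + 2) / ((n : ℝ) + 2) := by
      funext n; push_cast; ring_nf
    rw [hfun] at h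
    exact h
  -- the geometric majorant
  have hgeo : HasSum (fun n : ℕ => x ^ (n + 2) / 2) (x ^ 2 / (2 * (1 - x))) := by
    have h := (hasSum_geometric_of_lt_one h0 h1).mul_left (x ^ 2 / 2)
    have hfun2 : (fun i : ℕ => x ^ 2 / 2 * x ^ i) = fun n : ℕ => x ^ (n + 2) / 2 := by
      funext n; ring
    have hval : x ^ 2 / 2 * (1 - x)⁻¹ = x ^ 2 / (2 * (1 - x)) := by
      field_simp
    rw [hfun2, hval] at h
    exact h
  refine hasSum_le (fun n => ?_) htail hgeo
  have hx2 : 0 ≤ x ^ (n + 2) := pow_nonneg h0 _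
  exact div_le_div_of_nonneg_left hx2 (by norm_num) (by
    have : (0 : ℝ) ≤ n := Nat.cast_nonneg n
    linarith)

/-- **`OUModeEntropy` (registered stub `stub_ouModeEntropy` of line «cold_entropy», stmt-QuantumFields-24809)**:
for `v ≠ 0`, `κ, s > 0`, `KL(N(0, v(1 − e^{−2κs})) ‖ N(0, v)) ≤ e^{−4κs} / (4(1 − e^{−2κs}))`. [folklore] -/
theorem ouModeEntropy :
    ∀ (v : ℝ≥0), v ≠ 0 → ∀ κ s : ℝ, 0 < κ → 0 < s →
      InformationTheory.klDiv (ProbabilityTheory.gaussianReal 0 (v * (1 - Real.exp (-(2 * κ * s))).toNNReal))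
          (ProbabilityTheory.gaussianReal 0 v)
        ≤ ENNReal.ofReal (Real.exp (-(4 * κ * s)) / (4 * (1 - Real.exp (-(2 * κ * s))))) := by
  intro v hv κ s hκ hs
  set x : ℝ := Real.exp (-(2 * κ * s)) with hx
  have hx0 : 0 < x := Real.exp_pos _
  have hx1 : x < 1 := Real.exp_lt_one_iff.2 (by nlinarith)
  have h1x : 0 < 1 - x := by linarith
  have hnn : (1 - x).toNNReal = ⟨1 - x, h1x.le⟩ := Real.toNNReal_of_nonneg h1x.le
  have hw : v * (1 - x).toNNReal ≠ 0 := mul_ne_zero hv (by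
    rw [hnn]; exact fun h => h1x.ne' (congrArg (fun y : ℝ≥0 => (y : ℝ)) h))
  have hfin := klDiv_gaussianReal_centred_ne_top hw hv
  rw [← ENNReal.ofReal_toReal hfin]
  refine ENNReal.ofReal_le_ofReal ?_
  rw [toReal_klDiv_gaussianReal_centred hw hv]
  have hvpos : (0 : ℝ) < v := by exact_mod_cast pos_iff_ne_zero.2 hv
  have hratio : ((v * (1 - x).toNNReal : ℝ≥0) : ℝ) / v = 1 - x := by
    rw [NNReal.coe_mul, Real.coe_toNNReal _ h1x.le]
    field_simp
  rw [hratio]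
  have hkey := neg_log_one_sub_sub_le hx0.le hx1
  have hx2 : x ^ 2 = Real.exp (-(4 * κ * s)) := by
    rw [hx, ← Real.exp_nat_mul]; congr 1; ring
  rw [← hx2]
  have : (1 - x - 1 - Real.log (1 - x)) / 2 = (-Real.log (1 - x) - x) / 2 := by ring
  rw [this, div_le_iff₀ (by norm_num : (0 : ℝ) < 2)]
  calc -Real.log (1 - x) - x ≤ x ^ 2 / (2 * (1 - x)) := hkey
    _ = x ^ 2 / (4 * (1 - x)) * 2 := by field_simp; ring

end Summit.QuantumFields.YangMills.Theorems.ColdStartUniversality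

end
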